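import Summits.QuantumFields.BalabanUV.Beta.GAN24.DataColumnCombRows
import Summits.QuantumFields.BalabanUV.Beta.GAN24.WardPairingCoarse

/-!
# `BalabanUV.Beta.GAN24.MultiplierColumnCoarseGauge` — binder row G-an2-4 ∕ (CONV-C), the (S) row ∕ (W-γ) toolkit, EVERY LEVEL:
# **THE MULTIPLIER COLUMNS OF THE CO-DRESSED STEP RESOLVENTS ARE ORTHOGONAL TO EVERY BOUNDED COARSE PURE GAUGE** —
# `Σ'_y Σ_κ (dz Φ) κ y·colM G_j Lc ν y′ κ y = 0`, `Φ` bounded, `j = 0` and `j + 1`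
# (G-an2-4 CRUX TEAM (2), seat `b2b-balaban-gan24-formalise-leaf-06` = the (γ) hand, gen 49, FILE (T1b) — the corollary of FILE (T1) `DataColumnCombRows`)

NOT IN PRINT; OUR BOOKKEEPING ([folklore] BY NAME over FILE (T1) `DataColumnCombRows.tsum_curvAdj_curv_mul_colH_eq` ∕ `tsum_E2image_mul_colH_eq_all` (the column pairings for
EVERY bounded `m`), `AffineAveraging.contourSum_dz` ∕ `curv_dz`, an2's co-closedness `BorderedHessian.codiff₁_wΦ_right` and leaf-14's `MultiplierZeroMass.summable_wΦ`; 0 `def`,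
0 cited fact, 0 `def … : Prop`, 0 sorry).
HONEST FRAMING (cell contract, verbatim): «discharging `BetaPertH` makes Bałaban's UV stability UNCONDITIONAL — a real constructive-QFT result; it is NOT the continuum limit and NOT
the Clay problem.»  HONEST DEPENDENCY (verbatim): «continuum YM on T⁴ ⇐ BetaPertH ∧ nine spine estimates (0/9 proved); BetaPertH ⇐ (D1) ∧ (D4) ∧ CAP+tail; G-an2-4 gates asym,
D1 and NE2/3/4.»

WHY.  FILE (T1) reads an2's full composition identities `𝕄_j ∘ G_j = piKBmC` on the comb rows: the data columns of `G_j` satisfy Euler–Lagrange at EVERY bond, so the column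
pairing `⟨Δ_j m, colH⟩ = s_j·⟨𝒬_{Lc} m, colM⟩` holds for EVERY bounded `m`.  Taking `m := dz (Φ ∘ quo)` — a bounded pure gauge with an UNBOUNDEDLY supported potential (half-space
steps, slab indicators, block-periodic potentials: the test forms of the hyperplane-flux ∕ co-exactness arguments of the (γ) source pairing one level up, E29 [B′]) — the left side
vanishes (`d*d ∘ dz = 0` at `j = 0`; at `j + 1` the value-Hessian image of a BOUNDED pure gauge vanishes, §3 `tsum_wΦ_mul_grad_eq_zero_bdd`, the bounded-potential form of an2's
`ValueHessianGauge.tsum_wΦ_mul_grad_eq_zero`), and `𝒬_{Lc}(dz (Φ∘quo)) = Lc^{d+1}·dz Φ` (`contourSum_dz`): the multiplier column `colM G_j Lc ν y′` is orthogonal to `dz Φ` for every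
bounded coarse `Φ` — the multiplier response to a prescribed average is COARSE-DIVERGENCE-FREE in its row index (E29 (T1) COROLLARY «C h ⊥ exact»; by the symmetry of the `mm` block this
is the Ward law of the next value Hessian against bounded potentials).
* §1 `blockSum_comp_quo`, `abs_dz_le`, `contourSum_dz_comp_quo` (lattice bookkeeping; `curvAdj_curv_dz` is leaf-03 g63's `WardPairingCoarse.curvAdj_curv_dz` BY NAME).
* §2 **`tsum_dz_mul_colM_eq_zero`** (`G₀ = coDressKBmAt (toSite r) N (KInv N)`, every `N ≥ 1`, in-block root, `Φ` bounded) — at level 0 this is ALSO a corollary of leaf-03 g63's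
  `WardPairingCoarse.pow_mul_codiff₁_multiplierCol_eq` ∕ `multiplierWord_dz_eq_zero_of_coclosed` (the multiplier column of `G∘W` is coarse-co-closed when `W`'s field column is co-closed;
  a block-constant pure gauge is comb-free, so the comb-restricted `ward_pairing` suffices there); it is restated here in the `colM`∕coarse-potential currency of §3, whose level-(j+1)
  twin is NOT in the tree.
* §3 `tsum_wΦ_mul_grad_eq_zero_bdd` (`Σ'_y Σ_l wΦ κ l (x − y)·(φ(y + e_l) − φ y) = 0`, `φ` BOUNDED), **`tsum_dz_mul_colM_succ_eq_zero`** (`G_{j+1}`, every `j`).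
Asserts NO value of any resolvent column; NOTHING of (W-γ) at levels ≥ 1 ∕ (INV) ∕ (S) discharged; NEVER «G-an2-4 closed» as (CONV-C); NOT D1, NOT `BetaPertH`, NOT continuum,
NOT Clay.  2026-08-23; no existing file touched.
-/

noncomputable section

open Finset
open scoped BigOperators
open Literature.MathematicalPhysics.QuantumFieldTheory
open Literature.MathematicalPhysics.QuantumFieldTheory.Balaban1983to89
open Literature.MathematicalPhysics.QuantumFieldTheory.Balaban1983to89.Beta
open ExpKernelCalculus (Site MKer)
open AffineAveraging (Form0 Form1 box toSite unitVec unitVec_apply dz curv curvAdj codiff₁ blockSum contourSum curv_dz contourSum_dz)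
open LatticeForm (quo)
open KKTFluctuationEnergy (quo_zsmul_add_toSite)
open KernelSpecInstance (wΦ)
open OneStepResolventKernel (Fib KInv)
open OneStepKernelFamily (KInvStep colH)
open SecondOrderResponse (colM)
open BalabanStepJetsSucc (wVH)
open Summit.QuantumFields.BalabanUV.Beta.AxialDressingRooted (coDressKBmAt)
open Summit.QuantumFields.BalabanUV.Beta.BorderedHessian (stepScale stepScale_ne_zero codiff₁_wΦ_right)
open Summit.QuantumFields.BalabanUV.Beta.GAN24.MultiplierZeroMass (summable_wΦ)
open Summit.QuantumFields.BalabanUV.Beta.GAN24.RelInvWardPairing (summable_bdd_mul)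
open Summit.QuantumFields.BalabanUV.Beta.GAN24.DataColumnCombRows (tsum_curvAdj_curv_mul_colH_eq tsum_E2image_mul_colH_eq_all)
open Summit.QuantumFields.BalabanUV.Beta.GAN24.WardPairingCoarse (curvAdj_curv_dz)

namespace Summit.QuantumFields.BalabanUV.Beta.GAN24.MultiplierColumnCoarseGauge

variable {d : ℕ}

/-! ## §1 Lattice bookkeeping: pull-backs of coarse potentials -/

section CoarseGauge

/-- [folklore] The block sum of the pull-back of a coarse potential is `N^{d+1}` times the potential. -/
theorem blockSum_comp_quo {N : ℕ} [NeZero N] (Φ : Form0 (d + 1) ℝ) (y : Fin (d + 1) → ℤ) :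
    blockSum N (fun u : Fin (d + 1) → ℤ => Φ (quo N u)) y = ((N : ℝ) ^ (d + 1)) * Φ y := by
  unfold AffineAveraging.blockSum
  have e : ∀ b ∈ box (d + 1) N, Φ (quo N ((N : ℤ) • y + toSite b)) = Φ y := fun b hb => by rw [quo_zsmul_add_toSite (N := N) y hb]
  rw [Finset.sum_congr rfl e, Finset.sum_const, nsmul_eq_mul]
  have hcard : (box (d + 1) N).card = N ^ (d + 1) := by
    simp [AffineAveraging.box, Fintype.card_piFinset, Finset.card_range, Finset.prod_const, Finset.card_univ, Fintype.card_fin]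
  rw [hcard]
  push_cast
  ring

/-- [folklore] `dz` of a bounded potential is bounded by twice the bound. -/
theorem abs_dz_le {φ : Form0 (d + 1) ℝ} {B : ℝ} (hφ : ∀ u, |φ u| ≤ B) (κ : Fin (d + 1)) (u : Fin (d + 1) → ℤ) : |dz φ κ u| ≤ 2 * B := by
  unfold AffineAveraging.dz
  calc |φ (u + unitVec κ) - φ u| ≤ |φ (u + unitVec κ)| + |φ u| := abs_sub _ _
    _ ≤ B + B := add_le_add (hφ _) (hφ _)
    _ = 2 * B := by ring

/-- [folklore] The contour sum of `dz` of the pull-back of a coarse potential is `N^{d+1}·dz Φ`. -/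
theorem contourSum_dz_comp_quo {N : ℕ} [NeZero N] (Φ : Form0 (d + 1) ℝ) (κ : Fin (d + 1)) (y : Fin (d + 1) → ℤ) :
    contourSum N (dz fun u : Fin (d + 1) → ℤ => Φ (quo N u)) κ y = ((N : ℝ) ^ (d + 1)) * dz Φ κ y := by
  rw [contourSum_dz]
  simp only [AffineAveraging.dz, blockSum_comp_quo]
  ring

/-! ## §2 Level `0` -/

variable {N : ℕ} [NeZero N] {r : Fin (d + 1) → ℕ}

/-- NOT IN PRINT; OUR BOOKKEEPING.  **THE MULTIPLIER COLUMN OF `G₀` IS ORTHOGONAL TO EVERY BOUNDED COARSE PURE GAUGE**: for `G₀ = coDressKBmAt (toSite r) N (KInv N)` (in-block root),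
every coarse bond `(ν, y′)` and every BOUNDED coarse potential `Φ`, `Σ'_y Σ_κ (dz Φ) κ y·colM G₀ N ν y′ κ y = 0` — the multiplier response to a prescribed average is
coarse-divergence-free (§4 at `m := dz (Φ ∘ quo N)`: `d*d ∘ dz = 0`, `𝒬_N ∘ dz = dz ∘ blockSum`). -/
theorem tsum_dz_mul_colM_eq_zero (hr : r ∈ box (d + 1) N) {Φ : Form0 (d + 1) ℝ} {B : ℝ} (hΦ : ∀ y, |Φ y| ≤ B) (ν : Fin (d + 1)) (y' : Fin (d + 1) → ℤ) :
    ∑' y, ∑ κ, dz Φ κ y * colM (coDressKBmAt (toSite r) N (KInv (N := N))) N ν y' κ y = 0 := by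
  have hmB : ∀ κ u, |dz (fun u : Fin (d + 1) → ℤ => Φ (quo N u)) κ u| ≤ 2 * B := abs_dz_le (fun u => hΦ (quo N u))
  have h := tsum_curvAdj_curv_mul_colH_eq hr hmB ν y'
  simp only [curvAdj_curv_dz, Pi.zero_apply, zero_mul, Finset.sum_const_zero, tsum_zero, contourSum_dz_comp_quo] at h
  have e : (fun y => ∑ κ, (N : ℝ) ^ (d + 1) * dz Φ κ y * colM (coDressKBmAt (toSite r) N (KInv (N := N))) N ν y' κ y)
      = fun y => (N : ℝ) ^ (d + 1) * ∑ κ, dz Φ κ y * colM (coDressKBmAt (toSite r) N (KInv (N := N))) N ν y' κ y := by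
    funext y; rw [Finset.mul_sum]; exact Finset.sum_congr rfl fun κ _ => by ring
  rw [e, tsum_mul_left] at h
  have hN : ((N : ℝ) ^ (d + 1)) ≠ 0 := pow_ne_zero _ (Nat.cast_ne_zero.2 (NeZero.ne N))
  exact (mul_eq_zero.1 h.symm).resolve_left hN

end CoarseGauge

/-! ## §3 Level `j + 1` -/

section CoarseGaugeSucc

variable {Lc : ℕ} [NeZero Lc] {r : Fin (d + 1) → ℕ}
set_option maxHeartbeats 400000 in
/-- [folklore] **`wΦ` KILLS BOUNDED PURE GAUGES** (an2's `ValueHessianGauge.tsum_wΦ_mul_grad_eq_zero` for BOUNDED instead of finitely supported potentials; summability from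
`MultiplierZeroMass.summable_wΦ`, co-closedness `BorderedHessian.codiff₁_wΦ_right`): `Σ'_y Σ_l wΦ κ l (x − y)·(φ(y + e_l) − φ(y)) = 0`. -/
theorem tsum_wΦ_mul_grad_eq_zero_bdd {M : ℕ} [NeZero M] (κ : Fin (d + 1)) (x : Site (d + 1)) {φ : Site (d + 1) → ℝ} {B : ℝ} (hφ : ∀ u, |φ u| ≤ B) :
    ∑' y, ∑ l, wΦ (N := M) κ l (x - y) * (φ (y + unitVec l) - φ y) = 0 := by
  have hws : ∀ (l : Fin (d + 1)) (c : Site (d + 1)), Summable fun y : Site (d + 1) => |wΦ (N := M) κ l (c - y)| := fun l c => by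
    have h := ((Equiv.subLeft c).summable_iff.2 (summable_wΦ (N := M) κ l)).abs
    refine h.congr fun y => ?_
    simp [Equiv.subLeft]
  have hf : ∀ l : Fin (d + 1), Summable fun y => wΦ (N := M) κ l (x - y) * φ (y + unitVec l) := fun l => by
    have h := summable_bdd_mul (fun y => hφ (y + unitVec l)) (hws l x)
    exact h.congr fun y => by ring
  have hg : ∀ l : Fin (d + 1), Summable fun y => wΦ (N := M) κ l (x - y) * φ y := fun l => by
    have h := summable_bdd_mul hφ (hws l x)
    exact h.congr fun y => by ring
  have hfg : ∀ l : Fin (d + 1), Summable fun y => wΦ (N := M) κ l (x - y) * (φ (y + unitVec l) - φ y) := fun l =>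
    ((hf l).sub (hg l)).congr fun y => by ring
  have hs : ∀ l : Fin (d + 1), Summable fun y => wΦ (N := M) κ l (x - y + unitVec l) * φ y := fun l => by
    have h := summable_bdd_mul hφ (hws l (x + unitVec l))
    refine h.congr fun y => ?_
    rw [mul_comm]
    congr 2
    abel
  have hshift : ∀ l : Fin (d + 1), ∑' y, wΦ (N := M) κ l (x - y) * φ (y + unitVec l) = ∑' y, wΦ (N := M) κ l (x - y + unitVec l) * φ y := by
    intro l
    rw [← (Equiv.addRight (unitVec l)).tsum_eq (fun y => wΦ (N := M) κ l (x - y + unitVec l) * φ y)]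
    refine tsum_congr fun y => ?_
    simp only [Equiv.coe_addRight]
    congr 2
    abel
  calc ∑' y, ∑ l, wΦ (N := M) κ l (x - y) * (φ (y + unitVec l) - φ y)
      = ∑ l, ∑' y, wΦ (N := M) κ l (x - y) * (φ (y + unitVec l) - φ y) := Summable.tsum_finsetSum fun l _ => hfg l
    _ = ∑ l, ((∑' y, wΦ (N := M) κ l (x - y + unitVec l) * φ y) - ∑' y, wΦ (N := M) κ l (x - y) * φ y) := by
        refine Finset.sum_congr rfl fun l _ => ?_
        rw [← hshift l, ← (hf l).tsum_sub (hg l)]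
        exact tsum_congr fun y => by ring
    _ = ∑ l, ∑' y, (wΦ (N := M) κ l (x - y + unitVec l) - wΦ (N := M) κ l (x - y)) * φ y := by
        refine Finset.sum_congr rfl fun l _ => ?_
        rw [← (hs l).tsum_sub (hg l)]
        exact tsum_congr fun y => by ring
    _ = ∑' y, ∑ l, (wΦ (N := M) κ l (x - y + unitVec l) - wΦ (N := M) κ l (x - y)) * φ y :=
        (Summable.tsum_finsetSum fun l _ => ((hs l).sub (hg l)).congr fun y => by ring).symm
    _ = ∑' y, codiff₁ (fun l z => wΦ (N := M) κ l (x - z)) y * φ y := by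
        refine tsum_congr fun y => ?_
        rw [← Finset.sum_mul]
        congr 1
        simp only [codiff₁]
        refine Finset.sum_congr rfl fun l _ => ?_
        have e : x - (y - unitVec l) = x - y + unitVec l := by abel
        rw [e]
    _ = 0 := by simp [codiff₁_wΦ_right (N := M) κ x]

/-- NOT IN PRINT; OUR BOOKKEEPING.  **THE MULTIPLIER COLUMN OF `G_{j+1}` IS ORTHOGONAL TO EVERY BOUNDED COARSE PURE GAUGE** (every `j`, in-block root):
`Σ'_y Σ_κ (dz Φ) κ y·colM G_{j+1} Lc ν y′ κ y = 0` for every BOUNDED coarse potential `Φ` (§4 at `m := dz (Φ ∘ quo Lc)`; the value-Hessian image of a bounded pure gauge vanishes,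
`tsum_wΦ_mul_grad_eq_zero_bdd`; `stepScale ≠ 0`). -/
theorem tsum_dz_mul_colM_succ_eq_zero (hr : r ∈ box (d + 1) Lc) (j : ℕ) {Φ : Form0 (d + 1) ℝ} {B : ℝ} (hΦ : ∀ y, |Φ y| ≤ B) (ν : Fin (d + 1))
    (y' : Fin (d + 1) → ℤ) :
    ∑' y, ∑ κ, dz Φ κ y * colM (coDressKBmAt (toSite r) Lc (KInvStep (d := d) Lc (j + 1))) Lc ν y' κ y = 0 := by
  set φ : Site (d + 1) → ℝ := fun u => Φ (quo Lc u) with hφdef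
  have hφ : ∀ u, |φ u| ≤ B := fun u => hΦ (quo Lc u)
  have hmB : ∀ κ u, |dz φ κ u| ≤ 2 * B := abs_dz_le hφ
  have h := tsum_E2image_mul_colH_eq_all hr j hmB ν y'
  have hz : ∀ (u : Site (d + 1)) (κ : Fin (d + 1)), ∑' v, ∑ l : Fin (d + 1), wΦ (N := Lc ^ (j + 1)) κ l (u - v) * dz φ l v = 0 := fun u κ => by
    have := tsum_wΦ_mul_grad_eq_zero_bdd (M := Lc ^ (j + 1)) κ u hφ
    simpa [AffineAveraging.dz] using this
  simp only [hz, mul_zero, zero_mul, Finset.sum_const_zero, tsum_zero] at h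
  have e1 : ∀ (y : Fin (d + 1) → ℤ) (κ : Fin (d + 1)), contourSum Lc (dz φ) κ y = ((Lc : ℝ) ^ (d + 1)) * dz Φ κ y := fun y κ =>
    contourSum_dz_comp_quo Φ κ y
  simp only [e1] at h
  have e : (fun y => ∑ κ, (Lc : ℝ) ^ (d + 1) * dz Φ κ y
        * coDressKBmAt (toSite r) Lc (KInvStep (d := d) Lc (j + 1)) ((Lc : ℤ) • y) ((Lc : ℤ) • y') (Sum.inr κ) (Sum.inr ν))
      = fun y => (Lc : ℝ) ^ (d + 1) * ∑ κ, dz Φ κ y * colM (coDressKBmAt (toSite r) Lc (KInvStep (d := d) Lc (j + 1))) Lc ν y' κ y := by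
    funext y; rw [Finset.mul_sum]; exact Finset.sum_congr rfl fun κ _ => by rw [SecondOrderResponse.colM]; ring
  rw [e, tsum_mul_left] at h
  have hLc : ((Lc : ℝ) ^ (d + 1)) ≠ 0 := pow_ne_zero _ (Nat.cast_ne_zero.2 (NeZero.ne Lc))
  have h' := (mul_eq_zero.1 h.symm).resolve_left (stepScale_ne_zero (d := d) (Lc := Lc) (j + 1))
  exact (mul_eq_zero.1 h').resolve_left hLc

end CoarseGaugeSucc


end Summit.QuantumFields.BalabanUV.Beta.GAN24.MultiplierColumnCoarseGauge

end
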